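import Summits.BirchSwinnertonDyer.BirchSwinnertonDyer.Theorems.EisensteinPrimesKatzLineExistsOfTeichmuller
import Literature.NumberTheory.EllipticCurves.Hida2010MuInvariant.AnticyclotomicKatzMuInvariant
import Literature.NumberTheory.EllipticCurves.KellerYin2024.AnomalousLambdaInvariants
import Literature.NumberTheory.EllipticCurves.BDPAnticyclotomicPAdicLFunction
import HarnessLib

/-!
# Crux 2 `GoodLatticeBDPValue` (stmt-BirchSwinnertonDyer-19032), line `halves` v23: the two SUPPLIERS of the `μ`-input in the
# CGLS `R₀`-currency (`hKatzUnitAll` of `…GoodLatticeMuLambdaOfKatzUnit` / `…GoodLatticeBDPValueOfKatzUnit`)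
# (width seat `bsd-line-x1-p1-w5` gen 5; `--supports stmt-BirchSwinnertonDyer-19032`)

`hKatzUnitAll`: at the line's data (curve `W`, good anomalous Eisenstein `p > 2`, no unramified rational `p`-line; `K`
imaginary quadratic, (Heeg) for `N_W` and `p`, `D_K` odd `≠ −3`, `E(K)[p] = 0`; `ι, v, v̄, κ, γ`; a parametrisation datum
`Dt` with a BDP witness `L`; the Teichmüller pair `(θsub, θquot)` of a rational `p`-line `Φ`; `θ_K` a Hecke character of
`θquot|_{Γ_K}`), SOME `R₀`-valued CGLS-type witness `Lθ` of `θ_K` on the anticyclotomic line (`IsKatzLFunction ι' v v̄ ∅ κ γ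
θ_K Ω_K'' Ω_p'' Lθ`, non-zero periods) has a coefficient of norm `1`. Two suppliers, both from PUBLISHED / already-carried
named facts by name:

* §1 `katzUnitAll_of_thmI_katzLFunction` — from Hida 2010 Thm. I in its FIRST typing
  `Hida2010MuInvariant.thmI_mu_katzLFunction_eq_zero` (CGLS's own frame `IsKatzLFunction`, p432386) and CGLS Thm. 2.1.2
  (`thm212_exists_isKatzLFunction`, the witness: `KatzLineFrame.exists_isKatzLFunction_of_teichmullerPair`). With this
  supplier the line's Hida input is cited in ONE currency (the 2nd typing `thmI_mu_katzBranch_reflect_eq_zero`, introduced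
  because «the cross-frame comparison is not in the tree», is no longer needed: the comparison IS in the tree, p665992).
* §2 `katzUnitAll_of_anacong` — from the `μ`-clause `FirstUnitCoeffAt Lφ nφ` of [AN]
  `KellerYin2024.thm222_anacong_goodLattice_OPEN` (which halves v23 derives from 3a-A and `…_of_five_le` — both ALREADY
  antecedents; `_of_five_le` is the composition CGLS 2.2.2 ∘ Kriz ∘ Hida) and CGLS Thm. 2.1.2: with this supplier Hida's
  theorem is not cited by name at all on the line (named facts 12 → 11).

THEOREMS ONLY (no definition, no named fact introduced, no `sorry`); CONDITIONAL on the hypotheses they name; nothing about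
BSD / IMC2 / the crux is proved here. References: [Hida2010MuInvariant] Thm. I; [CastellaGrossiLeeSkinner2022] Thm. 2.1.2,
Thm. 2.2.2; [KellerYin2024] Thm. 2.2.2, §1.4; [Kriz2016] Thm. 35, Rem. 33.
-/

-- `Summit.BirchSwinnertonDyer.BirchSwinnertonDyer.…`: the summit and its single sub-problem share a name (D-0017 layout).
set_option linter.dupNamespace false
set_option autoImplicit false

noncomputable section

open scoped Classical MatrixGroups ModularForm

open WeierstrassCurve NumberField IsDedekindDomain Field CongruenceSubgroup
  Literature.NumberTheory.EllipticCurves Literature.NumberTheory.EllipticCurves.Rank1Residual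
  Literature.NumberTheory.EllipticCurves.ModularForms
  Literature.NumberTheory.GaloisRepresentations Literature.NumberTheory.QuadraticFields
  Literature.NumberTheory.EllipticCurves.CastellaGrossiLeeSkinner2022
  Literature.NumberTheory.EllipticCurves.KellerYin2024
  Literature.NumberTheory.EllipticCurves.Hida2010MuInvariant
  Summit.BirchSwinnertonDyer.BirchSwinnertonDyer.Theorems.EisensteinPrimesMuLambda
  Summit.BirchSwinnertonDyer.BirchSwinnertonDyer.Theorems.ResidualLineRigidity
  Summit.BirchSwinnertonDyer.Rank1Residual.X1.KellerYinMuLambdaSplit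
  Summit.BirchSwinnertonDyer.Rank1Residual.X11b

namespace Summit.BirchSwinnertonDyer.BirchSwinnertonDyer.Theorems.GoodLatticeBDPValueKatzUnitSuppliers

/-! ## §1 From Hida's Theorem I in CGLS's frame (first typing) and CGLS Thm. 2.1.2 -/

/-- **`hKatzUnitAll` from Hida 2010 Thm. I (CGLS currency) ∘ CGLS Thm. 2.1.2.** At the line's data, CGLS Thm. 2.1.2 gives an
`R₀`-valued Katz witness `Lθ` of `θ_K` on the anticyclotomic line (`KatzLineFrame.exists_isKatzLFunction_of_teichmullerPair`:
`𝟙̃^{p−1} = 1`, unramified outside `N_W` and at `p`), and Hida's Theorem I in the frame `IsKatzLFunction`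
(`thmI_mu_katzLFunction_eq_zero`, at `θ = 𝟙̃`, `C = N_W`, `Cbar = ∅`) gives `∃ n, FirstUnitCoeffAt Lθ n`, whose first clause
is a coefficient of norm `1`. CONDITIONAL on the two named facts; nothing else.
[cite: Hida2010MuInvariant, Thm. I (p. 45)] [cite: CastellaGrossiLeeSkinner2022, Thm. 2.1.2 (arXiv:2008.02571v2 TeX L1015–1041)]
[cite: KellerYin2024, §1.4 (arXiv:2402.12781v2 TeX L1063–1087)] -/
theorem katzUnitAll_of_thmI_katzLFunction (hI : thmI_mu_katzLFunction_eq_zero) (h212 : thm212_exists_isKatzLFunction) :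
    ∀ (W : WeierstrassCurve ℚ) [W.IsElliptic] [W.IsGloballyMinimal] (p : ℕ) [Fact p.Prime],
      2 < p → Good W p → Red W p → Anom W p →
      (∀ Φ : AddSubgroup (geomTorsion W (p : ℤ)), IsRationalLine W p Φ → ¬ LineUnramifiedAt W p Φ) →
      ∀ (K : Type) [Field K] [NumberField K], IsImaginaryQuadratic K →
        SatisfiesHeegnerHypothesis (W.conductorNorm ℤ) K → SatisfiesHeegnerHypothesis p K →
        Odd (NumberField.discr K) → NumberField.discr K ≠ -3 →
        (∀ Q : (W.baseChange K).toAffine.Point, p • Q = 0 → Q = 0) →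
      ∀ (ι : K →+* ℚ_[p]) (v vbar : HeightOneSpectrum (𝓞 K)),
        (∀ x : 𝓞 K, x ∈ v.asIdeal ↔ ‖ι (x : K)‖ < 1) →
        ((p : ℕ) : 𝓞 K) ∈ vbar.asIdeal → vbar ≠ v →
      ∀ (κ : ZpExtension K p), κ.IsAnticyclotomic →
      ∀ (γ : absoluteGaloisGroup K) [Fact (κ.IsTopGenerator γ)],
      ∀ (N : ℕ) [NeZero N] (Dt : ModularParametrizationData W N),
      ∀ (ι' : PadicAlgCl p ≃+* ℂ),
        (∀ (w : InfinitePlace K) (k : 𝓞 K), k ∈ v.asIdeal ↔ ‖ι'.symm (w.embedding (k : K))‖ < 1) →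
      ∀ (ΩK : ℂ) (Ωp : (unrIntegers p)ˣ) (L : UnrSeries p), ΩK ≠ 0 →
        IsBDPLFunction ι' v κ γ Dt.f ΩK ((Ωp : unrIntegers p) : ℂ_[p]) L →
      ∀ (Φ : AddSubgroup (geomTorsion W (p : ℤ))), IsRationalLine W p Φ →
      ∀ (θsub θquot : FramedGaloisRep ℚ (padicCoeffIntegers (∅ : Set (PadicAlgCl p))) 1),
        IsTeichmullerLiftOn (∅ : Set (PadicAlgCl p)) (Φ.map (geomTorsion W (p : ℤ)).subtype) θsub →
        IsTeichmullerLiftOnQuot (∅ : Set (PadicAlgCl p)) (Φ.map (geomTorsion W (p : ℤ)).subtype)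
          (geomTorsion W (p : ℤ)) θquot →
      ∀ (θK : HeckeCharacter K), IsHeckeCharOf ι' (θquot.restrictField K) θK →
      ∃ (ΩK'' : ℂ) (Ωp'' : ℂ_[p]) (Lθ : UnrSeries p), ΩK'' ≠ 0 ∧ Ωp'' ≠ 0 ∧
        IsKatzLFunction ι' v vbar ∅ κ γ θK ΩK'' Ωp'' Lθ ∧
        ∃ i : ℕ, ‖((PowerSeries.coeff i Lθ : unrIntegers p) : ℂ_[p])‖ = 1 := by
  intro W _ _ p _ hp hgood hred hanom hGL K _ _ hK hHN hHp hodd h3 hEK ι v vbar hv hvbar hne κ hκ γ _ N _ Dt ι' hι'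
    ΩK Ωp L hΩK hL Φ hΦ θsub θquot hsub hquot θK hθK
  -- the witness (CGLS Thm. 2.1.2 at the Teichmüller data)
  obtain ⟨ΩK'', Ωp'', Lθ, hΩK'', hLθ⟩ := KatzLineFrame.exists_isKatzLFunction_of_teichmullerPair h212 W p hp hgood
    hred hanom hGL hK hHN hHp hodd h3 hv hvbar hne hκ γ ι' hι' hΦ hquot hθK
  -- the side conditions of Hida's theorem at `θ = 𝟙̃`, `C = N_W`
  have hT1 : ∀ σ : absoluteGaloisGroup ℚ, θquot σ ^ (p - 1) = 1 := hquot.1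
  have hcardΦ : Nat.card (Φ.map (geomTorsion W (p : ℤ)).subtype) = p := by
    rw [Nat.card_congr (Φ.equivMapOfInjective (geomTorsion W (p : ℤ)).subtype
      (geomTorsion W (p : ℤ)).subtype_injective).toEquiv.symm, hΦ.1]
  have hunrp : ∀ u : HeightOneSpectrum (𝓞 ℚ), ((p : ℕ) : 𝓞 ℚ) ∈ u.asIdeal → θquot.IsUnramifiedAt u :=
    goodLatticeQuotCharUnramifiedAtPOnTree_holds W p hp hgood hred hanom hGL Φ hΦ θquot hquot
  have hunr : ∀ u : HeightOneSpectrum (𝓞 ℚ), ((W.conductorNorm ℤ : ℤ) : 𝓞 ℚ) ∉ u.asIdeal →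
      θquot.IsUnramifiedAt u := by
    intro u hu
    by_cases hpu : ((p : ℕ) : 𝓞 ℚ) ∈ u.asIdeal
    · exact hunrp u hpu
    · exact isUnramifiedAt_of_isTeichmullerLiftOnQuot W ∅ hcardΦ hquot
        (hasGoodReductionAt_of_conductorNorm_notMem W u hu) hpu
  obtain ⟨n, hn⟩ := hI p hp K hK hHp hodd h3 ι v vbar hv hvbar hne κ hκ γ ι' hι' θquot hT1 (W.conductorNorm ℤ) hHN
    hunr hunrp θK hθK ∅ (by simp) ΩK'' Ωp'' Lθ hΩK'' hLθ
  have hΩp'' : ((Ωp'' : unrIntegers p) : ℂ_[p]) ≠ 0 := by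
    rw [← norm_pos_iff, Halves.norm_coe_units_unrIntegers]
    exact one_pos
  exact ⟨ΩK'', ((Ωp'' : unrIntegers p) : ℂ_[p]), Lθ, hΩK'', hΩp'', hLθ, n, hn.1⟩

/-! ## §2 From the `μ`-clause of [AN] (KY Thm. 2.2.2 shape, all odd `p`) and CGLS Thm. 2.1.2 -/

/-- **`hKatzUnitAll` from [AN] `thm222_anacong_goodLattice_OPEN` ∘ CGLS Thm. 2.1.2.** At the line's data: CGLS Thm. 2.1.2
gives an `R₀`-valued Katz witness `Lθ` of `θ_K` (`Cbar = ∅`); the restricted Teichmüller pair is a residual pair over `K`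
(`isResidualPairOver_restrictField`); with the BDP witness `L` in hand, [AN] yields `∃ n nφ, FirstUnitCoeffAt L n ∧
FirstUnitCoeffAt Lθ nφ ∧ …`, and the second clause is the unit coefficient. On halves v23 [AN] is not a new input: it is
`GoodLatticeBDPValueAnThreeBookkeeping.thm222_OPEN_of_fullDescentDatum_of_five_le ⟨3a-A⟩ ⟨_of_five_le⟩`. CONDITIONAL on the
two named hypotheses; nothing else. [claim: KellerYin2024, status: under-review]
[cite: KellerYin2024, Thm. 2.2.2 (anacong; arXiv:2402.12781v2 TeX L1445–1448)]
[cite: CastellaGrossiLeeSkinner2022, Thm. 2.1.2, Thm. 2.2.2 with (2.16)] [cite: Hida2010MuInvariant, Thm. I (inside CGLS 2.2.2 / `_of_five_le`)] -/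
theorem katzUnitAll_of_anacong (han : thm222_anacong_goodLattice_OPEN) (h212 : thm212_exists_isKatzLFunction) :
    ∀ (W : WeierstrassCurve ℚ) [W.IsElliptic] [W.IsGloballyMinimal] (p : ℕ) [Fact p.Prime],
      2 < p → Good W p → Red W p → Anom W p →
      (∀ Φ : AddSubgroup (geomTorsion W (p : ℤ)), IsRationalLine W p Φ → ¬ LineUnramifiedAt W p Φ) →
      ∀ (K : Type) [Field K] [NumberField K], IsImaginaryQuadratic K →
        SatisfiesHeegnerHypothesis (W.conductorNorm ℤ) K → SatisfiesHeegnerHypothesis p K →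
        Odd (NumberField.discr K) → NumberField.discr K ≠ -3 →
        (∀ Q : (W.baseChange K).toAffine.Point, p • Q = 0 → Q = 0) →
      ∀ (ι : K →+* ℚ_[p]) (v vbar : HeightOneSpectrum (𝓞 K)),
        (∀ x : 𝓞 K, x ∈ v.asIdeal ↔ ‖ι (x : K)‖ < 1) →
        ((p : ℕ) : 𝓞 K) ∈ vbar.asIdeal → vbar ≠ v →
      ∀ (κ : ZpExtension K p), κ.IsAnticyclotomic →
      ∀ (γ : absoluteGaloisGroup K) [Fact (κ.IsTopGenerator γ)],
      ∀ (N : ℕ) [NeZero N] (Dt : ModularParametrizationData W N),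
      ∀ (ι' : PadicAlgCl p ≃+* ℂ),
        (∀ (w : InfinitePlace K) (k : 𝓞 K), k ∈ v.asIdeal ↔ ‖ι'.symm (w.embedding (k : K))‖ < 1) →
      ∀ (ΩK : ℂ) (Ωp : (unrIntegers p)ˣ) (L : UnrSeries p), ΩK ≠ 0 →
        IsBDPLFunction ι' v κ γ Dt.f ΩK ((Ωp : unrIntegers p) : ℂ_[p]) L →
      ∀ (Φ : AddSubgroup (geomTorsion W (p : ℤ))), IsRationalLine W p Φ →
      ∀ (θsub θquot : FramedGaloisRep ℚ (padicCoeffIntegers (∅ : Set (PadicAlgCl p))) 1),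
        IsTeichmullerLiftOn (∅ : Set (PadicAlgCl p)) (Φ.map (geomTorsion W (p : ℤ)).subtype) θsub →
        IsTeichmullerLiftOnQuot (∅ : Set (PadicAlgCl p)) (Φ.map (geomTorsion W (p : ℤ)).subtype)
          (geomTorsion W (p : ℤ)) θquot →
      ∀ (θK : HeckeCharacter K), IsHeckeCharOf ι' (θquot.restrictField K) θK →
      ∃ (ΩK'' : ℂ) (Ωp'' : ℂ_[p]) (Lθ : UnrSeries p), ΩK'' ≠ 0 ∧ Ωp'' ≠ 0 ∧
        IsKatzLFunction ι' v vbar ∅ κ γ θK ΩK'' Ωp'' Lθ ∧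
        ∃ i : ℕ, ‖((PowerSeries.coeff i Lθ : unrIntegers p) : ℂ_[p])‖ = 1 := by
  intro W _ _ p _ hp hgood hred hanom hGL K _ _ hK hHN hHp hodd h3 hEK ι v vbar hv hvbar hne κ hκ γ _ N _ Dt ι' hι'
    ΩK Ωp L hΩK hL Φ hΦ θsub θquot hsub hquot θK hθK
  -- the witness (CGLS Thm. 2.1.2 at the Teichmüller data)
  obtain ⟨ΩK'', Ωp'', Lθ, hΩK'', hLθ⟩ := KatzLineFrame.exists_isKatzLFunction_of_teichmullerPair h212 W p hp hgood
    hred hanom hGL hK hHN hHp hodd h3 hv hvbar hne hκ γ ι' hι' hΦ hquot hθK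
  -- the residual pair over `K` and the finite set of places dividing `N_W`
  have hpairK : IsResidualPairOver (W.baseChange K) p (θsub.restrictField K) (θquot.restrictField K) :=
    isResidualPairOver_restrictField W p K hΦ hsub hquot
  have hN0 : W.conductorNorm ℤ ≠ 0 := (W.conductorNorm_pos_holds).ne'
  obtain ⟨Sf, hSf⟩ := exists_finset_places_dvd (K := K) (N := W.conductorNorm ℤ) hN0
  -- [AN] at these data, `Cbar = ∅`
  obtain ⟨-, nφ, -, hnφ, -⟩ := han W p hp hgood hred hanom hGL K hK hHN hHp hodd h3 hEK ι v vbar hv hvbar hne κ hκ γ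
    N Dt ι' hι' ΩK Ωp L hΩK hL (θsub.restrictField K) (θquot.restrictField K) hpairK Sf hSf θK hθK ∅ (by simp)
    ΩK'' Ωp'' Lθ hΩK'' hLθ
  have hΩp'' : ((Ωp'' : unrIntegers p) : ℂ_[p]) ≠ 0 := by
    rw [← norm_pos_iff, Halves.norm_coe_units_unrIntegers]
    exact one_pos
  exact ⟨ΩK'', ((Ωp'' : unrIntegers p) : ℂ_[p]), Lθ, hΩK'', hΩp'', hLθ, nφ, hnφ.1⟩

end Summit.BirchSwinnertonDyer.BirchSwinnertonDyer.Theorems.GoodLatticeBDPValueKatzUnitSuppliers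

end
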